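import Mathlib
import HarnessLib
import Summits.HubbardSuperconductivity.HubbardSuperconductivity.Theses.ChiralWindow
import Literature.MathematicalPhysics.QuantumLattice.DWaveOrderParameterProofs
import Summits.HubbardSuperconductivity.HubbardSuperconductivity.Theorems.ChiralWindowCwChiralConstructionKLWindowOfPoint
import Summits.HubbardSuperconductivity.HubbardSuperconductivity.Theorems.ChiralWindowCwChiralConstructionLevelWindowTransfer
import Summits.HubbardSuperconductivity.HubbardSuperconductivity.Theorems.ChiralWindowCwChiralConstructionFillingAtNegThreeTenths
import Summits.HubbardSuperconductivity.HubbardSuperconductivity.Theorems.ChiralWindowCwChiralConstructionOfKLMechanism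
import Summits.HubbardSuperconductivity.HubbardSuperconductivity.Theorems.CwChiralConstruction.Negative.CooperLegendreCeiling

/-!
# STRATEGY CENSUS, gen 1 — Lean companion (crux `CwChiralConstruction`, stmt-HubbardSuperconductivity-1740)

Crux-strategist seat planner-cstrat-stmt-HubbardSuperconductivity-1740-s1-0, 2026-08-17. Companion of
`Cruxes/CwChiralConstruction/STRATEGY-CENSUS.md` (gen 1). Everything here ELABORATES and is sorry-free; nothing is
asserted (all open statements are `def … : Prop`). Contents:

* §0 the two open stubs of the live skeleton (`Lines/ladder_scale_transfer.lean` rev c7-2) as named Props —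
  (Kpt) `KLLeadingAtWindowDoping`, (M) `DWaveOrderFloorOnLeadingWindows` — and the SPLIT GLUE
  `crux_of_Kpt_of_M : (Kpt) → (M) → CwChiralConstruction` (composition of landed p141740 / p141417 / p142268;
  identical to the evidence file `ChiralWindowCwChiralConstructionSplit.lean`, theorem `CwChiralConstruction_of_subs`).
* §D6 the STAIR SPLIT of (M) along the source strength at a `U`-dependent stair `h₁(U) = exp(-C₁/U²)`:
  (UP) `StairFloorOnLeadingWindows` — a floor `exp(-C/U²)` on the ONE stair `F(U,μ,h₁(U))` (fixed, exponentially
  small source: no massless Goldstone mode) — and (IR) `SourceRemovalStabilityOnLeadingWindows` — a `U`-UNIFORM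
  ratio `θ·F(U,μ,h₁(U)) ≤ F(U,μ,h)` for all `h < h₁(U)` (the Goldstone half, record-free). Kernel-checked:
  `M_of_UP_of_IR : (UP) → (IR) → (M)` (staircase `le_dWaveOrderParameter_iff_forall` + monotonicity of the stair)
  and `UP_of_M : (M) → (UP)` ((UP) is a CONSEQUENCE of (M) — a weakest-unknown-consequence piece), hence
  `crux_of_Kpt_of_UP_of_IR`.
* §S6 the two-sided asymptotic strengthening `TwoSidedKLLawOnLeadingWindows` and `M_of_twoSided`.

`F(U,μ,h) := liminf_L dWaveSourceDensity (L+1) U μ h` is written out (`stair`). Disproof used: §A staircase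
(every statement here is stair-aware), §B (source on, punctured filter: untouched), §C ceiling (imported; the
floors here are `exp(-C/U²)` on the OPEN interval `(0,U₀)`, §D/§G).
-/

set_option linter.dupNamespace false

noncomputable section

namespace Summit.HubbardSuperconductivity.HubbardSuperconductivity.Cruxes.CwChiralConstruction.StrategyCensusG1

open Literature.MathematicalPhysics.QuantumLattice Filter
open Summit.HubbardSuperconductivity.HubbardSuperconductivity.Theses.ChiralWindow
open Summit.HubbardSuperconductivity.HubbardSuperconductivity.Theorems
open scoped Topology

/-! ## §0 The live skeleton's two stubs as Props, and the split glue -/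

/-- The Kohn–Luttinger leading hypothesis on a level window (shared hypothesis shape of (M), (UP), (IR)). -/
def KLLeadingOn (μ₁ μ₂ γ U₁ : ℝ) : Prop :=
  ∀ U ∈ Set.Ioo (0:ℝ) U₁, ∀ μ ∈ Set.Icc μ₁ μ₂, ∀ χ : D4Irrep, χ ≠ D4Irrep.B1g →
    channelInf (squareDispersion 1 0) μ U D4Irrep.B1g + γ * U ^ 2 ≤ channelInf (squareDispersion 1 0) μ U χ

/-- (Kpt) — `B₁g` strictly leading, margin `γU²`, at ONE window doping (stub `stub_klLeadingAtWindowDoping`, verbatim). -/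
def KLLeadingAtWindowDoping : Prop :=
  ∃ δ₀ ∈ Set.Icc (3/10 : ℝ) (12/25), ∃ γ U₁ : ℝ, 0 < γ ∧ 0 < U₁ ∧ ∀ U ∈ Set.Ioo (0:ℝ) U₁,
    ∀ χ : D4Irrep, χ ≠ D4Irrep.B1g →
      channelInf (squareDispersion 1 0) (chemicalPotentialOfDensity (squareDispersion 1 0) (1 - δ₀)) U D4Irrep.B1g
          + γ * U ^ 2 ≤
        channelInf (squareDispersion 1 0) (chemicalPotentialOfDensity (squareDispersion 1 0) (1 - δ₀)) U χ

/-- (M) — the Kohn–Luttinger mechanism in local uniform form (stub `stub_dWaveOrderFloorOnLeadingWindows`, verbatim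
up to the named hypothesis `KLLeadingOn`, which unfolds definitionally). -/
def DWaveOrderFloorOnLeadingWindows : Prop :=
  ∀ μ₁ μ₂ γ U₁ : ℝ, -2 ≤ μ₁ → μ₁ < μ₂ → μ₂ ≤ -(3:ℝ) / 10 → 0 < γ → 0 < U₁ → KLLeadingOn μ₁ μ₂ γ U₁ →
    ∃ U₀ C : ℝ, 0 < U₀ ∧ 0 < C ∧ ∀ U ∈ Set.Ioo (0:ℝ) U₀, ∀ μ ∈ Set.Icc (μ₁ + U / 2) μ₂,
      Real.exp (-C / U ^ 2) ≤ dWaveOrderParameter U μ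

/-- **Split glue** `(Kpt) → (M) → CwChiralConstruction` (= `CwChiralConstruction_of` of the live skeleton with its two
stubs abstracted; composition of landed p141740, p141417, p142268). [cite: KohnLuttinger1965] [cite: KomaTasaki1994, §1] -/
theorem crux_of_Kpt_of_M (hKpt : KLLeadingAtWindowDoping) (hM : DWaveOrderFloorOnLeadingWindows) :
    CwChiralConstruction := by
  obtain ⟨μ₁, μ₂, γ, U₁, _h4, h12, _h0, hγ, hU₁, hn₁, hn₂, hK⟩ := stub_klLeadingMuWindowOfPoint hKpt
  have hμ₁ : -2 ≤ μ₁ := by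
    by_contra hlt
    have hlt : μ₁ < -2 := not_le.mp hlt
    have := monotone_filling hlt.le
    linarith [filling_neg_two_le_half']
  have hμ₂ : μ₂ ≤ -(3:ℝ) / 10 := by
    by_contra hlt
    have hlt : -(3:ℝ) / 10 < μ₂ := not_le.mp hlt
    have := monotone_filling hlt.le
    linarith [stub_fillingAtNegThreeTenths]
  exact cwChiralConstruction_of_orderFloorOnCertifiedLevelWindow h12 hn₁ hn₂
    (hM μ₁ μ₂ γ U₁ hμ₁ h12 hμ₂ hγ hU₁ hK)

/-! ## §D6 The stair split of (M): fixed-source floor (UP) and source-removal stability (IR) -/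

/-- The stair `F(U,μ,h) = liminf_L m_{L+1}(h)` of the Koma–Tasaki staircase (Disproof §A). -/
def stair (U μ h : ℝ) : ℝ :=
  liminf (fun L : ℕ => dWaveSourceDensity (L + 1) U μ h) atTop

/-- The `U`-dependent stair height `h₁(U) = exp(-C₁/U²)`. -/
def stairHeight (C₁ U : ℝ) : ℝ := Real.exp (-C₁ / U ^ 2)

theorem stairHeight_pos (C₁ U : ℝ) : 0 < stairHeight C₁ U := Real.exp_pos _

/-- (UP) **Fixed-source floor below (or at) the Kohn–Luttinger scale.** On every KL-leading level window and for EVERY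
stair exponent `C₁ > 0`: a floor `exp(-C/U²) ≤ F(U, μ, exp(-C₁/U²))` on the single stair `h₁(U) = exp(-C₁/U²)`, for all
small `U` and all operator levels of the window. With the source FIXED at `h₁(U) > 0` the `U(1)` phase mode is massive: the
statement contains the symmetric regime (bandwidth → ladder scale) and the explicitly-seeded broken regime down to the
scale `h₁`, but NOT the `h ↓ 0` Goldstone problem. A consequence of (M) (`UP_of_M`). -/
def StairFloorOnLeadingWindows : Prop :=
  ∀ μ₁ μ₂ γ U₁ : ℝ, -2 ≤ μ₁ → μ₁ < μ₂ → μ₂ ≤ -(3:ℝ) / 10 → 0 < γ → 0 < U₁ → KLLeadingOn μ₁ μ₂ γ U₁ →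
    ∀ C₁ : ℝ, 0 < C₁ → ∃ U₀ C : ℝ, 0 < U₀ ∧ 0 < C ∧ ∀ U ∈ Set.Ioo (0:ℝ) U₀, ∀ μ ∈ Set.Icc (μ₁ + U / 2) μ₂,
      Real.exp (-C / U ^ 2) ≤ stair U μ (stairHeight C₁ U)

/-- (IR) **Source-removal stability (the Goldstone half, record-free).** On every KL-leading level window there are a
stair exponent `C₁ > 0` and a `U`-UNIFORM ratio `θ > 0` such that, for all small `U` and all operator levels of the
window, removing the source below the stair keeps a fixed fraction of the sourced order:
`θ · F(U, μ, exp(-C₁/U²)) ≤ F(U, μ, h)` for every `h ∈ (0, exp(-C₁/U²))`. Not implied by (M) (the ratio is uniform in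
`U`); with ANY positive `F` on the stair it already yields qualitative `d`-wave order, so it is crux-hard. -/
def SourceRemovalStabilityOnLeadingWindows : Prop :=
  ∀ μ₁ μ₂ γ U₁ : ℝ, -2 ≤ μ₁ → μ₁ < μ₂ → μ₂ ≤ -(3:ℝ) / 10 → 0 < γ → 0 < U₁ → KLLeadingOn μ₁ μ₂ γ U₁ →
    ∃ C₁ θ U₀ : ℝ, 0 < C₁ ∧ 0 < θ ∧ 0 < U₀ ∧ ∀ U ∈ Set.Ioo (0:ℝ) U₀, ∀ μ ∈ Set.Icc (μ₁ + U / 2) μ₂,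
      ∀ h ∈ Set.Ioo (0:ℝ) (stairHeight C₁ U), θ * stair U μ (stairHeight C₁ U) ≤ stair U μ h

/-- Arithmetic of the glue: for `0 < U ≤ 1` and `c ≥ log(1/θ)` (`0 < θ`), `exp(-(C+c)/U²) ≤ θ·exp(-C/U²)`. -/
theorem exp_shift_le_mul {U C c θ : ℝ} (hU : 0 < U) (hU1 : U ≤ 1) (hθ : 0 < θ) (hc : -Real.log θ ≤ c)
    (hc0 : 0 ≤ c) :
    Real.exp (-(C + c) / U ^ 2) ≤ θ * Real.exp (-C / U ^ 2) := by
  have hU2 : 0 < U ^ 2 := by positivity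
  have hU2le : U ^ 2 ≤ 1 := by nlinarith
  -- `exp(-(C+c)/U²) = exp(-C/U²) * exp(-c/U²)` and `exp(-c/U²) ≤ exp(-c) ≤ θ`
  have hsplit : -(C + c) / U ^ 2 = -C / U ^ 2 + -c / U ^ 2 := by ring
  rw [hsplit, Real.exp_add, mul_comm]
  refine mul_le_mul_of_nonneg_right ?_ (Real.exp_pos _).le
  have h1 : -c / U ^ 2 ≤ -c := by
    rw [div_le_iff₀ hU2]
    nlinarith
  have h2 : Real.exp (-c) ≤ θ := by
    have : -c ≤ Real.log θ := by linarith
    calc Real.exp (-c) ≤ Real.exp (Real.log θ) := Real.exp_le_exp.mpr this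
      _ = θ := Real.exp_log hθ
  exact (Real.exp_le_exp.mpr h1).trans h2

/-- **(UP) ∧ (IR) ⇒ (M)** (kernel-checked glue of the stair split). Pick `C₁, θ` from (IR); (UP) at that `C₁` gives the
floor `exp(-C/U²)` on the stair `h₁(U)`; below the stair (IR) keeps `θ·exp(-C/U²) ≥ exp(-(C+c)/U²)` (`c = max 0 (-log θ)`,
`U ≤ 1`); above the stair the staircase is non-decreasing (`liminf_dWaveSourceDensity_mono`); so every stair carries
`exp(-(C+c)/U²)` and `le_dWaveOrderParameter_iff_forall` concludes. [cite: KomaTasaki1994, §1] -/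
theorem M_of_UP_of_IR (hUP : StairFloorOnLeadingWindows) (hIR : SourceRemovalStabilityOnLeadingWindows) :
    DWaveOrderFloorOnLeadingWindows := by
  intro μ₁ μ₂ γ U₁ hμ₁ h12 hμ₂ hγ hU₁ hK
  obtain ⟨C₁, θ, U₀', hC₁, hθ, hU₀', HIR⟩ := hIR μ₁ μ₂ γ U₁ hμ₁ h12 hμ₂ hγ hU₁ hK
  obtain ⟨U₀'', C, hU₀'', hC, HUP⟩ := hUP μ₁ μ₂ γ U₁ hμ₁ h12 hμ₂ hγ hU₁ hK C₁ hC₁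
  set c : ℝ := max 0 (-Real.log θ) with hc
  have hc0 : 0 ≤ c := le_max_left _ _
  have hcl : -Real.log θ ≤ c := le_max_right _ _
  refine ⟨min (min U₀' U₀'') 1, C + c, lt_min (lt_min hU₀' hU₀'') one_pos, by linarith, fun U hU μ hμ => ?_⟩
  have hU0 : 0 < U := hU.1
  have hU' : U < U₀' := lt_of_lt_of_le hU.2 ((min_le_left _ _).trans (min_le_left _ _))
  have hU'' : U < U₀'' := lt_of_lt_of_le hU.2 ((min_le_left _ _).trans (min_le_right _ _))
  have hU1 : U ≤ 1 := (lt_of_lt_of_le hU.2 (min_le_right _ _)).le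
  have hfloor : Real.exp (-C / U ^ 2) ≤ stair U μ (stairHeight C₁ U) := HUP U ⟨hU0, hU''⟩ μ hμ
  have hshift : Real.exp (-(C + c) / U ^ 2) ≤ θ * Real.exp (-C / U ^ 2) := exp_shift_le_mul hU0 hU1 hθ hcl hc0
  have hθexp : θ * Real.exp (-C / U ^ 2) ≤ Real.exp (-C / U ^ 2) := by
    -- `θ ≤ 1` is not assumed; but `θ·x ≤ x` is only needed when `θ ≤ 1`; in general use the stair itself:
    -- we avoid this lemma below by a case split on `h < h₁` / `h₁ ≤ h`.
    by_cases hθ1 : θ ≤ 1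
    · have := Real.exp_pos (-C / U ^ 2)
      nlinarith
    · -- if `θ > 1`, (IR) at any `h < h₁` gives `θ F(h₁) ≤ F(h) ≤ F(h₁)` hence `F(h₁) ≤ 0 <` floor: contradiction-free
      -- bound still holds since we only use `hshift` and (IR) below; provide the trivial bound via monotonicity:
      have hθ1' : 1 < θ := not_le.mp hθ1
      have hpos : 0 ≤ stair U μ (stairHeight C₁ U) := liminf_dWaveSourceDensity_nonneg U μ (stairHeight_pos C₁ U).le
      -- from (IR) at `h = h₁/2`: `θ F(h₁) ≤ F(h₁/2) ≤ F(h₁)`, so `(θ-1) F(h₁) ≤ 0`, so `F(h₁) = 0`; then the floor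
      -- `exp(-C/U²) ≤ 0` is absurd — so this branch is vacuous:
      exfalso
      have hh : stairHeight C₁ U / 2 ∈ Set.Ioo (0:ℝ) (stairHeight C₁ U) :=
        ⟨by have := stairHeight_pos C₁ U; linarith, by have := stairHeight_pos C₁ U; linarith⟩
      have h1 := HIR U ⟨hU0, hU'⟩ μ hμ _ hh
      have h2 : stair U μ (stairHeight C₁ U / 2) ≤ stair U μ (stairHeight C₁ U) :=
        liminf_dWaveSourceDensity_mono U μ hh.1.le hh.2.le
      have h3 : stair U μ (stairHeight C₁ U) ≤ 0 := by nlinarith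
      have h4 : 0 < Real.exp (-C / U ^ 2) := Real.exp_pos _
      linarith
  rw [le_dWaveOrderParameter_iff_forall]
  intro h hh
  by_cases hlt : h < stairHeight C₁ U
  · -- below the stair: (IR)
    have := HIR U ⟨hU0, hU'⟩ μ hμ h ⟨hh, hlt⟩
    calc Real.exp (-(C + c) / U ^ 2) ≤ θ * Real.exp (-C / U ^ 2) := hshift
      _ ≤ θ * stair U μ (stairHeight C₁ U) := mul_le_mul_of_nonneg_left hfloor hθ.le
      _ ≤ stair U μ h := this
  · -- at or above the stair: monotonicity of the staircase
    have hle : stairHeight C₁ U ≤ h := not_lt.mp hlt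
    calc Real.exp (-(C + c) / U ^ 2) ≤ θ * Real.exp (-C / U ^ 2) := hshift
      _ ≤ Real.exp (-C / U ^ 2) := hθexp
      _ ≤ stair U μ (stairHeight C₁ U) := hfloor
      _ ≤ stair U μ h := liminf_dWaveSourceDensity_mono U μ (stairHeight_pos C₁ U).le hle

/-- **(M) ⇒ (UP)**: a floor on the order parameter is a floor on EVERY stair (`dWaveOrderParameter_le_liminf`), in
particular on `h₁(U)`; so (UP) is a consequence of (M) (and of the crux on its own window) — the weakest-unknown-
consequence half of the stair split. [cite: KomaTasaki1994, §1] -/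
theorem UP_of_M (hM : DWaveOrderFloorOnLeadingWindows) : StairFloorOnLeadingWindows := by
  intro μ₁ μ₂ γ U₁ hμ₁ h12 hμ₂ hγ hU₁ hK C₁ _hC₁
  obtain ⟨U₀, C, hU₀, hC, H⟩ := hM μ₁ μ₂ γ U₁ hμ₁ h12 hμ₂ hγ hU₁ hK
  refine ⟨U₀, C, hU₀, hC, fun U hU μ hμ => ?_⟩
  exact (H U hU μ hμ).trans (dWaveOrderParameter_le_liminf U μ (stairHeight_pos C₁ U))

/-- The crux from (Kpt), (UP), (IR). [cite: KohnLuttinger1965] [cite: KomaTasaki1994, §1] -/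
theorem crux_of_Kpt_of_UP_of_IR (hKpt : KLLeadingAtWindowDoping) (hUP : StairFloorOnLeadingWindows)
    (hIR : SourceRemovalStabilityOnLeadingWindows) : CwChiralConstruction :=
  crux_of_Kpt_of_M hKpt (M_of_UP_of_IR hUP hIR)

/-! ## §S6 The two-sided asymptotic strengthening -/

/-- (S6) **Two-sided Kohn–Luttinger law** on leading windows: floor `exp(-A/U²)` AND ceiling `exp(-A'/U²)` on the order
parameter, uniformly on the window. The ceiling half is a refuter-side statement BELOW the Cooper logarithm (the landed
ceiling is only `K(1+|log U|)√U`, `Negative/CooperLegendreCeiling`); the floor half is (M). -/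
def TwoSidedKLLawOnLeadingWindows : Prop :=
  ∀ μ₁ μ₂ γ U₁ : ℝ, -2 ≤ μ₁ → μ₁ < μ₂ → μ₂ ≤ -(3:ℝ) / 10 → 0 < γ → 0 < U₁ → KLLeadingOn μ₁ μ₂ γ U₁ →
    ∃ U₀ A A' : ℝ, 0 < U₀ ∧ 0 < A' ∧ A' ≤ A ∧ ∀ U ∈ Set.Ioo (0:ℝ) U₀, ∀ μ ∈ Set.Icc (μ₁ + U / 2) μ₂,
      Real.exp (-A / U ^ 2) ≤ dWaveOrderParameter U μ ∧ dWaveOrderParameter U μ ≤ Real.exp (-A' / U ^ 2)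

/-- (S6) ⇒ (M) by projection — the added conjunct gives the lower bound no handle. -/
theorem M_of_twoSided (h : TwoSidedKLLawOnLeadingWindows) : DWaveOrderFloorOnLeadingWindows := by
  intro μ₁ μ₂ γ U₁ hμ₁ h12 hμ₂ hγ hU₁ hK
  obtain ⟨U₀, A, A', hU₀, hA', hAA', H⟩ := h μ₁ μ₂ γ U₁ hμ₁ h12 hμ₂ hγ hU₁ hK
  exact ⟨U₀, A, hU₀, by linarith, fun U hU μ hμ => (H U hU μ hμ).1⟩

/-! ## Sanity anchors (landed Negative lemma imported, crux protocol) -/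

/-- The adversary's ceiling on the level range `[-2,-3/10]` (Disproof §C, `Negative/CooperLegendreCeiling`): every floor
above is `exp(-C/U²)` on `(0, U₀)`, far below `K(1+|log U|)√U`. [cite: KomaTasaki1994, §1] -/
theorem ceiling_anchor :
    ∃ K : ℝ, 0 < K ∧ ∀ U μ : ℝ, 0 < U → U ≤ 1 → μ ∈ Set.Icc (-(2:ℝ)) (-(3:ℝ) / 10) →
      dWaveOrderParameter U μ ≤ K * (1 + |Real.log U|) * Real.sqrt U :=
  Summit.HubbardSuperconductivity.CwChiralConstruction.Negative.dWaveOrderParameter_le_sqrt _ _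
    (by norm_num) (by norm_num) (by norm_num)

end Summit.HubbardSuperconductivity.HubbardSuperconductivity.Cruxes.CwChiralConstruction.StrategyCensusG1

end
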